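import Summits.ResolutionOfSingularities.ResolutionOfSingularities.Theorems.PurelyInseparableDim4WideBaseChange
import Summits.ResolutionOfSingularities.ResolutionOfSingularities.Theorems.PurelyInseparableDim4ResConeResidue
import HarnessLib

/-!
# K2(p) MAY BE CHECKED OVER ALGEBRAICALLY CLOSED FIELDS: above-floor isolated chains, and res-dim4-p-12 g2's
# located constant-`(d, e_G)` residue, go up along any homomorphism of fields (cell `res-dim4-pi`)

[OURS · counted 0 · AI work weaker than expert review.]  Cell `res-dim4-pi` (D-0157 DOOR 2), seat `res-dim4-p-3` g2;
the K2 twin of res-dim4-p-1 g2's `…WideBaseChange` (p670597, wide chains).  Bookkeeping only — NOTHING here proves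
K2(p) (`RidgeBudget.NoAboveFloorTrap p p`), `NoIsolatedTrap p p`, the Cossart–Jannsen–Saito theorem or resolution of
singularities in dimension ≥ 4 / characteristic `p`.

* §1 `aboveFloorChain_map`: the image along `f : K →+* L` of an isolated `Step0 q` chain avoiding the floor
  `ord₀ = q` is again such a chain (res-dim4-p-14's `IsolatedChainBaseChange.isolatedChain_map` + `ord₀` invariance).
* §2 `noAboveFloorTrap_of_forall_isAlgClosed` / `…_perfectField` / `noAboveFloorTrap_iff_forall_isAlgClosed`:
  K2 at `(p, q)` holds as soon as no ALGEBRAICALLY CLOSED (resp. perfect) field of characteristic `p` carries such a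
  chain.
* §3 the letters of the located residue are base-change invariant: `resForm_map` (the residual cone `in(F)/x^r`
  commutes with `map f`), `shade_map`, `finrank_resVertex_map` (`e_G`, by
  `PointBlowup.finrank_additiveSubspace_map_ringHom`), `support_map'`.
* §4 `noAboveFloorTrap_of_forall_isAlgClosed_located`: K2(p) (`p` prime) holds as soon as no algebraically closed
  field of characteristic `p` carries p-12 g2's LOCATED chain (`ResCone.noAboveFloorTrap_iff_noLocatedTrap`,
  p670526: `x^{r₀} ∣ F₀`, constant natural shade `d ∈ [1, 2p − 2]`, constant `e_G = e ∈ [2, 4]`) — so every K2(p)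
  sub-lemma may assume `K = K̄` (p-th roots of coefficients, roots of binary forms) at no cost.

bears_on: LADDER-RESOLUTION:D157-DOOR2 (res-dim4-pi · K2(p)).  Supports stmt-ResolutionOfSingularities-16155
(helper).
-/

set_option linter.dupNamespace false -- mandated namespace of this single-conjunct summit

noncomputable section

namespace Summit.ResolutionOfSingularities.ResolutionOfSingularities.Theorems.PIDim4

namespace K2BaseChange

open MvPolynomial
open Literature.AlgebraicGeometry.Resolution
open Literature.AlgebraicGeometry.Resolution.CentreBlowup
open Literature.AlgebraicGeometry.Resolution.Hauser2010
open Literature.AlgebraicGeometry.Resolution.HauserPerlega2019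
open RidgeBudget (NoAboveFloorTrap)
open ResCone (resForm resVertex)


/-! ## §1 Above-floor isolated chains go up -/

/-- **Above-floor isolated chains go up**: the image along `f : K →+* L` of an isolated `Step0 q` chain none of
whose states has `ord₀ = q` is again such a chain. [folklore] -/
theorem aboveFloorChain_map {K L : Type} [Field K] [Field L] [DecidableEq K] [DecidableEq L] (f : K →+* L)
    {q : ℕ} {c : ℕ → State K}
    (hc : ∀ k, IsIsolated q (c k).F ∧ Step0 q (c k) (c (k + 1)) ∧ ordZero (c k).F ≠ q) :
    ∀ k, IsIsolated q ((⟨MvPolynomial.map f (c k).F, (c k).r, (c k).exc⟩ : State L)).F ∧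
      Step0 q (⟨MvPolynomial.map f (c k).F, (c k).r, (c k).exc⟩ : State L)
        ⟨MvPolynomial.map f (c (k + 1)).F, (c (k + 1)).r, (c (k + 1)).exc⟩ ∧
      ordZero ((⟨MvPolynomial.map f (c k).F, (c k).r, (c k).exc⟩ : State L)).F ≠ q := by
  have hmap := IsolatedChainBaseChange.isolatedChain_map f (fun k => ⟨(hc k).1, (hc k).2.1⟩)
  intro k
  refine ⟨(hmap k).1, (hmap k).2, ?_⟩
  show ordZero (MvPolynomial.map f (c k).F) ≠ q
  rw [RidgeBudget.ordZero_map_ringHom]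
  exact (hc k).2.2

/-! ## §2 K2 may be checked over algebraically closed / perfect fields -/

/-- **K2 MAY BE CHECKED OVER ALGEBRAICALLY CLOSED FIELDS**: if no algebraically closed field of characteristic
`p` carries an infinite isolated `Step0 q` chain avoiding `ord₀ = q`, then `NoAboveFloorTrap p q`. [folklore] -/
theorem noAboveFloorTrap_of_forall_isAlgClosed (p q : ℕ)
    (h : ∀ (L : Type) [Field L] [IsAlgClosed L] [CharP L p] [DecidableEq L],
      ¬ ∃ c : ℕ → State L, ∀ k, IsIsolated q (c k).F ∧ Step0 q (c k) (c (k + 1)) ∧ ordZero (c k).F ≠ q) :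
    NoAboveFloorTrap p q := by
  intro K _ _ _
  rintro ⟨c, hc⟩
  letI : DecidableEq (AlgebraicClosure K) := Classical.decEq _
  exact h (AlgebraicClosure K) ⟨_, aboveFloorChain_map (algebraMap K (AlgebraicClosure K)) hc⟩

/-- **K2 may be checked over PERFECT fields.** [folklore] -/
theorem noAboveFloorTrap_of_forall_perfectField (p q : ℕ)
    (h : ∀ (L : Type) [Field L] [CharP L p] [PerfectField L] [DecidableEq L],
      ¬ ∃ c : ℕ → State L, ∀ k, IsIsolated q (c k).F ∧ Step0 q (c k) (c (k + 1)) ∧ ordZero (c k).F ≠ q) :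
    NoAboveFloorTrap p q :=
  noAboveFloorTrap_of_forall_isAlgClosed p q fun L _ _ _ _ => h L

/-- The equivalence: `NoAboveFloorTrap p q` iff no ALGEBRAICALLY CLOSED field of characteristic `p` carries an
infinite isolated above-floor `Step0 q` chain. [folklore] -/
theorem noAboveFloorTrap_iff_forall_isAlgClosed (p q : ℕ) :
    NoAboveFloorTrap p q ↔ ∀ (L : Type) [Field L] [IsAlgClosed L] [CharP L p] [DecidableEq L],
      ¬ ∃ c : ℕ → State L, ∀ k, IsIsolated q (c k).F ∧ Step0 q (c k) (c (k + 1)) ∧ ordZero (c k).F ≠ q :=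
  ⟨fun h L _ _ _ _ => h L, noAboveFloorTrap_of_forall_isAlgClosed p q⟩

/-- The same with PERFECT fields. [folklore] -/
theorem noAboveFloorTrap_iff_forall_perfectField (p q : ℕ) :
    NoAboveFloorTrap p q ↔ ∀ (L : Type) [Field L] [CharP L p] [PerfectField L] [DecidableEq L],
      ¬ ∃ c : ℕ → State L, ∀ k, IsIsolated q (c k).F ∧ Step0 q (c k) (c (k + 1)) ∧ ordZero (c k).F ≠ q :=
  ⟨fun h L _ _ _ _ => h L, noAboveFloorTrap_of_forall_perfectField p q⟩

/-! ## §3 The letters of the located residue under base change -/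

/-- `divMonomial` commutes with `map`. [folklore] -/
theorem divMonomial_map {K L : Type} [Field K] [Field L] (f : K →+* L) (P : MvPolynomial (Fin 4) K)
    (r : Fin 4 →₀ ℕ) : (MvPolynomial.map f P).divMonomial r = MvPolynomial.map f (P.divMonomial r) := by
  ext e
  rw [coeff_divMonomial, coeff_map, coeff_map, coeff_divMonomial]

/-- The initial form commutes with `map` (ring-hom form of `HauserPerlega2019.initialForm_map`).
[cite: CossartJannsenSaito2020, Def. 2.18] -/
theorem initialForm_map_ringHom {K L : Type} [Field K] [Field L] (f : K →+* L) (F : MvPolynomial (Fin 4) K) :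
    initialForm (MvPolynomial.map f F) = MvPolynomial.map f (initialForm F) := by
  letI : Algebra K L := f.toAlgebra
  rw [show f = algebraMap K L from rfl, HauserPerlega2019.initialForm_map]

/-- **The residual cone commutes with base change**: `in(F ⊗ 1)/x^r = (in(F)/x^r) ⊗ 1`. [folklore] -/
theorem resForm_map {K L : Type} [Field K] [Field L] (f : K →+* L) (s : State K) :
    resForm (⟨MvPolynomial.map f s.F, s.r, s.exc⟩ : State L) = MvPolynomial.map f (resForm s) := by
  unfold ResCone.resForm
  simp only
  rw [initialForm_map_ringHom, divMonomial_map]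

/-- **The shade is base-change invariant.** [cite: Hauser2010, §F] -/
theorem shade_map {K L : Type} [Field K] [Field L] (f : K →+* L) (s : State K) :
    (⟨MvPolynomial.map f s.F, s.r, s.exc⟩ : State L).shade = s.shade := by
  unfold CState.shade
  simp only
  rw [RidgeBudget.ordZero_map_ringHom]

/-- **`e_G` is base-change invariant**: the polar kernel of the residual cone has the same dimension after any
extension of the ground field. [cite: CossartJannsenSaito2020, Lemma 2.20 (2) and Def. 2.21] -/
theorem finrank_resVertex_map {K L : Type} [Field K] [Field L] (f : K →+* L) (s : State K) :
    Module.finrank L (resVertex (⟨MvPolynomial.map f s.F, s.r, s.exc⟩ : State L)) =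
      Module.finrank K (resVertex s) := by
  unfold ResCone.resVertex
  rw [resForm_map]
  exact PointBlowup.finrank_additiveSubspace_map_ringHom f (resForm s)

/-- The support (hence the condition `x^r ∣ F`, read on exponents) is base-change invariant. [folklore] -/
theorem support_map' {K L : Type} [Field K] [Field L] (f : K →+* L) (F : MvPolynomial (Fin 4) K) :
    (MvPolynomial.map f F).support = F.support :=
  MvPolynomial.support_map_of_injective F f.injective

/-- **Located chains go up**: the image of p-12 g2's located chain (`x^{r₀} ∣ F₀`, isolated, `Step0 p`, above the
floor, constant shade `d`, constant `e_G = e`) along `f : K →+* L` is a located chain with the same `(d, e)`.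
[folklore] -/
theorem locatedChain_map {K L : Type} [Field K] [Field L] [DecidableEq K] [DecidableEq L] (f : K →+* L)
    {p : ℕ} {c : ℕ → State K} {d : ℕ∞} {e : ℕ} (hr0 : ∀ e' ∈ (c 0).F.support, (c 0).r ≤ e')
    (hc : ∀ k, IsIsolated p (c k).F ∧ Step0 p (c k) (c (k + 1)) ∧ ordZero (c k).F ≠ p ∧
      (c k).shade = d ∧ Module.finrank K (resVertex (c k)) = e) :
    (∀ e' ∈ ((⟨MvPolynomial.map f (c 0).F, (c 0).r, (c 0).exc⟩ : State L)).F.support,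
        ((⟨MvPolynomial.map f (c 0).F, (c 0).r, (c 0).exc⟩ : State L)).r ≤ e') ∧
      ∀ k, IsIsolated p ((⟨MvPolynomial.map f (c k).F, (c k).r, (c k).exc⟩ : State L)).F ∧
        Step0 p (⟨MvPolynomial.map f (c k).F, (c k).r, (c k).exc⟩ : State L)
          ⟨MvPolynomial.map f (c (k + 1)).F, (c (k + 1)).r, (c (k + 1)).exc⟩ ∧
        ordZero ((⟨MvPolynomial.map f (c k).F, (c k).r, (c k).exc⟩ : State L)).F ≠ p ∧
        (⟨MvPolynomial.map f (c k).F, (c k).r, (c k).exc⟩ : State L).shade = d ∧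
        Module.finrank L (resVertex (⟨MvPolynomial.map f (c k).F, (c k).r, (c k).exc⟩ : State L)) = e := by
  have hmap := aboveFloorChain_map f (fun k => ⟨(hc k).1, (hc k).2.1, (hc k).2.2.1⟩)
  refine ⟨?_, fun k => ⟨(hmap k).1, (hmap k).2.1, (hmap k).2.2, ?_, ?_⟩⟩
  · intro e' he'
    have he'' : e' ∈ (c 0).F.support := by
      have h := support_map' f (c 0).F
      exact h ▸ he'
    exact hr0 e' he''
  · rw [shade_map]; exact (hc k).2.2.2.1
  · rw [finrank_resVertex_map]; exact (hc k).2.2.2.2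

/-! ## §4 The located residue of K2(p) may be checked over algebraically closed fields -/

/-- **K2(p) FROM THE LOCATED RESIDUE OVER ALGEBRAICALLY CLOSED FIELDS** (`p` prime): if no algebraically closed
field of characteristic `p` carries an isolated above-floor `Step0 p` chain with `x^{r₀} ∣ F₀`, constant natural
shade `d ∈ [1, 2p − 2]` and constant `e_G = e ∈ [2, 4]`, then `NoAboveFloorTrap p p`.  (p-12 g2's
`ResCone.noAboveFloorTrap_iff_noLocatedTrap` over every field, then §3.) [OURS · bookkeeping]
[cite: CossartJannsenSaito2020, Thm. 3.14] -/
theorem noAboveFloorTrap_of_forall_isAlgClosed_located (p : ℕ) [Fact p.Prime]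
    (h : ∀ (L : Type) [Field L] [IsAlgClosed L] [CharP L p] [DecidableEq L],
      ¬ ∃ (c : ℕ → State L) (d e : ℕ), 1 ≤ d ∧ d ≤ 2 * p - 2 ∧ 2 ≤ e ∧ e ≤ 4 ∧
        (∀ e' ∈ (c 0).F.support, (c 0).r ≤ e') ∧
        ∀ k, IsIsolated p (c k).F ∧ Step0 p (c k) (c (k + 1)) ∧ ordZero (c k).F ≠ p ∧
          (c k).shade = (d : ℕ∞) ∧ Module.finrank L (resVertex (c k)) = e) :
    NoAboveFloorTrap p p := by
  rw [ResCone.noAboveFloorTrap_iff_noLocatedTrap p]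
  intro K _ _ _
  rintro ⟨c, d, e, hd1, hd2, he2, he4, hr0, hc⟩
  letI : DecidableEq (AlgebraicClosure K) := Classical.decEq _
  obtain ⟨hr0', hc'⟩ := locatedChain_map (algebraMap K (AlgebraicClosure K)) hr0 hc
  exact h (AlgebraicClosure K) ⟨_, d, e, hd1, hd2, he2, he4, hr0', hc'⟩

/-- The same over PERFECT fields. [OURS · bookkeeping] [cite: CossartJannsenSaito2020, Thm. 3.14] -/
theorem noAboveFloorTrap_of_forall_perfectField_located (p : ℕ) [Fact p.Prime]
    (h : ∀ (L : Type) [Field L] [CharP L p] [PerfectField L] [DecidableEq L],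
      ¬ ∃ (c : ℕ → State L) (d e : ℕ), 1 ≤ d ∧ d ≤ 2 * p - 2 ∧ 2 ≤ e ∧ e ≤ 4 ∧
        (∀ e' ∈ (c 0).F.support, (c 0).r ≤ e') ∧
        ∀ k, IsIsolated p (c k).F ∧ Step0 p (c k) (c (k + 1)) ∧ ordZero (c k).F ≠ p ∧
          (c k).shade = (d : ℕ∞) ∧ Module.finrank L (resVertex (c k)) = e) :
    NoAboveFloorTrap p p :=
  noAboveFloorTrap_of_forall_isAlgClosed_located p fun L _ _ _ _ => h L

/-- **THE EQUIVALENCE**: K2(p) iff no ALGEBRAICALLY CLOSED field of characteristic `p` carries a located chain.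
[OURS · bookkeeping] [cite: CossartJannsenSaito2020, Thm. 3.14] -/
theorem noAboveFloorTrap_iff_forall_isAlgClosed_located (p : ℕ) [Fact p.Prime] :
    NoAboveFloorTrap p p ↔ ∀ (L : Type) [Field L] [IsAlgClosed L] [CharP L p] [DecidableEq L],
      ¬ ∃ (c : ℕ → State L) (d e : ℕ), 1 ≤ d ∧ d ≤ 2 * p - 2 ∧ 2 ≤ e ∧ e ≤ 4 ∧
        (∀ e' ∈ (c 0).F.support, (c 0).r ≤ e') ∧
        ∀ k, IsIsolated p (c k).F ∧ Step0 p (c k) (c (k + 1)) ∧ ordZero (c k).F ≠ p ∧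
          (c k).shade = (d : ℕ∞) ∧ Module.finrank L (resVertex (c k)) = e := by
  refine ⟨fun h L _ _ _ _ => ?_, noAboveFloorTrap_of_forall_isAlgClosed_located p⟩
  exact ((ResCone.noAboveFloorTrap_iff_noLocatedTrap p).mp h) L

end K2BaseChange

end Summit.ResolutionOfSingularities.ResolutionOfSingularities.Theorems.PIDim4

end
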